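import Summits.HodgeConjecture.HodgeConjecture.Theorems.Ring2AbelianAllAndreFibreClassDivisorialOfHodgeType
import Literature.AlgebraicGeometry.Motives.WeilJacobianDimension
import Literature.AlgebraicGeometry.HodgeTheory.FermatLinearSubspaceComplexPoints
import HarnessLib

/-!
# Ring 2 · sub-cell AbelianAll (ALL ABELIAN VARIETIES), André axis, part XV-a — a NO-GO for the fibre-class
# Lefschetz node (β′_f): a correspondence of `𝒳` which is BALANCED with respect to the fibre class
# (`γ ∪ pr₂^*[𝒳_t] = γ ∪ pr₁^*[𝒳_t]` on `𝒳 × 𝒳` — in particular every correspondence COMMUTING with the base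
# Lefschetz operator `L = ∪[𝒳_t]`) NEVER witnesses a clause `p ≤ d` of (β′_f): `j_s^* ∘ γ^* ∘ L_t = 0`

HONEST FRAMING (page 1, verbatim): **research route, not a corollary; conditional on HC_CM plus one named
minimal statement.** Cell line: research route conditional on HC_CM; not a corollary; Q11.4-sentence-2
already refuted in dim ≥ 3. Nothing in this file proves a case of the Hodge conjecture for an abelian variety.
`HC_CM` = `Theses.RankFourFaces.CMAbelianHodge` (a BINDER), item `Theses.RankFourFaces.CMToAbelian` (stmt-16267)
OPEN and not closed here. Seat `pub-hodge-ring2-ab-andre-2`, gen 7; owed item (o17) of RING2-MAP §AbelianAll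
AA2.45/AA2.47 ("the W₆ non-product cycle: are the relative Poincaré-bundle / Fourier–Mukai correspondences of the
abelian scheme candidates for the `p = 3` quasi-inverse?") — ANSWERED IN THE NEGATIVE by a kernel theorem.

## What is proved (theorems only; no definition, no named fact, no sorry)

Throughout `f : 𝒳 ⟶ S` is a compact pencil of abelian `d`-folds (`hf : IsCompactAbelianPencil f d`), `[𝒳_t] :=
j_{t*} 1 ∈ H²(𝒳(ℂ); ℂ)` its fibre class (`fiberGysin hf t 0 1`; independent of `t`, part XIII-e (φ)), and
`L_t := j_{t*} j_t^* = ∪[𝒳_t]` (part V `fiberGysin_map_fiberι_eq_cupProduct`) the operator that (β′_f) inverts.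

* §1 **The fibre class dies on every fibre**: `j_s^*[𝒳_t] = 0` for ALL `s, t` (`map_fiberι_fiberGysin_one_eq_zero`;
  support of the Gysin class off `𝒳_{t'}` for a second point `t' ≠ s` of the infinite curve `S(ℂ)`, disjointness of
  fibres, (φ)); hence `j_s^*(y ∪ [𝒳_t]) = 0`, **`j_s^* ∘ L_t = 0`** (`map_fiberι_fiberGysin_map_fiberι_eq_zero`), and
  `[𝒳_t] ∪ [𝒳_{t'}] = 0` (`cupProduct_fiberGysin_one_eq_zero`).
* §2 **Balanced correspondences commute with cup product** (general `W`, `X` smooth projective,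
  `corrClassAction` of Voisin II (10.7) for ANY orientations `μ`, `ν`, `ν` satisfying Poincaré duality): if
  `γ ∈ H^{2e}((W ⊗ X)(ℂ))` satisfies `γ ∪ pr_X^* F = γ ∪ pr_W^* G` (`F ∈ Hᵏ(X)`, `G ∈ Hᵏ(W)`) then
  `γ^*(c ∪ F) = γ^*(c) ∪ G` (`corrClassAction_cupProduct_of_balanced`; associativity, graded commutativity in even
  degree `2e`, projection formula `pr_{W!}(y ∪ pr_W^* x) = pr_{W!} y ∪ x`, the tree's `gysinMap_cupProduct_map`), and
  `γ^*(c ∪ F) = 0` outright when `deg c + 2e < 2 dim X` (`corrClassAction_cupProduct_eq_zero_of_balanced_of_lt`: the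
  push-forward lands in `H_{>2 dim W}(W(ℂ)) = 0`).
* §3 **THE NO-GO.** `exists_map_fiberι_ne_zero`: for `p ≤ d` some class of `H²ᵖ(𝒳)` survives on the fibre (`K_sᵖ ≠
  0`). `map_fiberι_apply_fiberGysin_eq_zero_of_commute`: ANY linear `T` with `T(x ∪ [𝒳_{t₀}]) = T'(x) ∪ [𝒳_{t₁}]`
  satisfies `j_s^* T L_t = 0`. **`map_fiberι_corrClassAction_fiberGysin_eq_zero_of_balanced`**: for every class
  `γ ∈ H^{2e}((𝒳 ⊗ 𝒳)(ℂ))` balanced with respect to the fibre class, `γ ∪ pr₂^*[𝒳_{t₀}] = γ ∪ pr₁^*[𝒳_{t₀}]`, and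
  all orientations, `j_s^*(γ^*(L_t W)) = 0` for all `W ∈ H²ᵖ(𝒳)`, `t`, `s` (degree `p = 0` by §2's vanishing,
  `p ≥ 1` by §2's commutation and §1). **`not_fibreClassLefschetz_clause_of_balanced`**: hence for `p ≤ d` such a
  `γ^*` is NOT a witness of clause `p` of `FibreClassLefschetzOn hf` — whatever its algebraicity.

## Reading (RING2-MAP §AbelianAll (ab-andre-2, gen 7); o17)

(β′_f) asks, in each degree `p ≤ d`, for an ALGEBRAIC class `Z` on `𝒳 × 𝒳` with `j_s^* Z^*(W ∪ [𝒳_t]) = j_s^* W`.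
Part XIV showed that PRODUCT cycles `D × A` do it exactly when the invariant classes are algebraic and liftable
((N_p)), which on the Weil habitat (W_E)₃ contains the W₆ question itself (AA2.45). The natural NON-product
candidates are the relative cycles of the abelian scheme `𝒳/S` — graphs of `[n]` and of endomorphisms /
isogenies over `S`, the rigidified Poincaré bundle on `𝒳 ×_S 𝒳^t` and the relative Fourier–Mukai transform,
Deninger–Murre's canonical projectors `πᵢ ∈ CH^d(𝒳 ×_S 𝒳)` (`ᵗΓ_n ∘ πᵢ = nⁱ πᵢ`), Künnemann's relative Lefschetz
operators `L, Λ ∈ CH(𝒳 ×_S 𝒳)`. ALL of them are classes `i_* γ'` supported on the fibre product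
`i : 𝒳 ×_S 𝒳 ↪ 𝒳 × 𝒳`, on which `pr₁^* f^*[t] = pr₂^* f^*[t]`; by the projection formula `i_*γ' ∪ pr₂^*[𝒳_t] =
i_*(γ' ∪ i^*pr₂^*[𝒳_t]) = i_*(γ' ∪ i^* pr₁^*[𝒳_t]) = i_*γ' ∪ pr₁^*[𝒳_t]`: they are BALANCED (in print; the identity
`[𝒳_t] = f^*[t]` is Fulton 19.1 / Voisin I §11.1.2 and is not a tree identity, which is why "balanced" — a
cohomological identity on the carriers — is the hypothesis here), so by §3 they act on fibre restrictions as
`j_s^* ∘ (i_*γ')^* ∘ L_t = 0` in EVERY degree: the relative half (η) of `B(𝒳)` (AA2.5: Künnemann / ACLS 2025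
Prop. 4.2) is orthogonal to the base half (β). More generally any `Z` with `Z ∪ (pr₁^*[𝒳_t] - pr₂^*[𝒳_t]) = 0`
(e.g. `Z` supported over the diagonal of `S × S`, or over a single fibre of either projection, `[𝒳_t]² = 0`) is
excluded. CONSEQUENCE for the smallest open instance (supersedes AA2.45's wording): the codimension-6 cycle `Z` on
the 14-fold `𝒳 × 𝒳` sought for a (W_E)₃-pencil must be (i) outside the span of exterior products through
algebraic classes of `𝒳` (AA2.45) AND (ii) UNBALANCED: `Z ∪ pr₁^*[𝒳_t] ≠ Z ∪ pr₂^*[𝒳_t]` — it must dominate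
`S × S` with unequal "row" and "column" slices; no cycle in the abelian-scheme toolkit (Beauville 1986 /
Deninger–Murre 1991 / Künnemann 1993 / Moonen 2024) has this shape, and André's motivated inverse `*_L L *_L`
(Andre1996 §2, Prop. 3.3) is the only printed candidate, algebraic iff (essentially) `B(𝒳)`.

NOT CLAIMED: that relative cycles are balanced ON THE CARRIERS (needs `j_{t*}1 = f^*[t]`, not in the tree); any
statement about `B(𝒳)`; any case of the Hodge conjecture. The theorems are unconditional and fact-free.

References: Abdulali1994FamiliesAV (Conj. 5.3, Thm. 5.5, p. 1130); Andre1996Motifs (§2.1 p. 14, Prop. 3.3 p. 21,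
§5.2); VoisinHodgeII2003 (proof of Thm. 10.17 (10.7); §9.2.4); FultonYoungTableaux1997 (App. B §B.1 (5)–(6), §B.2
Ex. 5); Fulton1998 (§19.1 Prop. 19.1.1, Example 10.3.2); HatcherAT2002 (§3.2 Prop. 3.10, Thm. 3.11, §3.3 Thm. 3.26,
p. 241); DeningerMurre1991 (Thm. 3.1, §2); Kunnemann1993 (Thm. 3.1.1 ff.); Beauville1986.
-/

noncomputable section

set_option linter.dupNamespace false

namespace Summit.HodgeConjecture.HodgeConjecture.Ring2.AbelianAll

open CategoryTheory AlgebraicGeometry MonoidalCategory CartesianMonoidalCategory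
open Literature.AlgebraicGeometry Literature.AlgebraicGeometry.Motives
open Literature.AlgebraicGeometry.HodgeTheory
open Literature.AlgebraicTopology.SingularHomology (singularCohomology singularHomology cupProduct capProduct
  cupProduct_assoc cupProduct_gradedComm_holds cupProduct_capProduct capProduct_map gysinMap
  gysinMap_cupProduct_map capProduct_gysinMap poincareDualityMap_apply gysinMap_restrictCompl_eq_zero_of_field
  HomologicalOrientation)
open Literature.Geometry.Kaehler (HasHardLefschetzProperty)

variable {𝒳 S : SchemeOver ℂ}

/-! ## §1 The fibre class dies on every fibre: `j_s^*[𝒳_t] = 0`, hence `j_s^* ∘ L_t = 0` and `[𝒳_t]² = 0` -/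

/-- The Gysin class `[𝒳_t] = j_{t*} 1` restricts to zero on the complement of (the image of) the fibre `𝒳_t`
(support property of Gysin maps, Fulton App. B §B.2 Ex. 5, the tree's `complexGysin_restrictCompl_eq_zero` over the
PROVED `gysinMap_restrictCompl_eq_zero_of_field ℂ`; the complement of `j_t⁻¹(j_t(𝒳_t))` has no complex points).
[cite: FultonYoungTableaux1997, Appendix B §B.2 Exercise 5] [cite: Voisin2025, §4.1 (p. 38)] -/
theorem restrictCompl_range_fiberGysin_one_eq_zero {d : ℕ} {f : 𝒳 ⟶ S} (hf : IsCompactAbelianPencil f d)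
    (t : ComplexPoints S) :
    complexBetti.restrictCompl 𝒳 (Set.range (fiberι f t).left.base) (2 * (0 + 1))
      (fiberGysin hf t 0 (singularCohomology.one ℂ (ComplexPoints (fiberOver f t)))) = 0 := by
  have hcl : IsClosed (Set.range (fiberι f t).left.base) := by
    haveI := isProper_left_of_isSmoothProjective (hf.isSmoothProjective_fiberOver t) hf.isSmoothProjective_total
      (fiberι f t)
    exact (fiberι f t).left.isClosedMap.isClosed_range
  refine complexGysin_restrictCompl_eq_zero (gysinMap_restrictCompl_eq_zero_of_field ℂ) complexOrientationFamily
    hasPoincareDuality_complexOrientationFamily (hf.isSmoothProjective_fiberOver t) hf.isSmoothProjective_total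
    (fiberι f t) _ hcl _ ?_
  haveI : IsEmpty (Motives.complexPointsCompl (fiberOver f t)
      ((fiberι f t).left.base ⁻¹' Set.range (fiberι f t).left.base)) :=
    ⟨fun P ↦ P.2 ⟨P.1.pt, rfl⟩⟩
  haveI := ModuleCat.subsingleton_of_isZero (Motives.isZero_singularCohomology_of_isEmpty ℂ ℂ
    (E := Motives.complexPointsCompl (fiberOver f t) ((fiberι f t).left.base ⁻¹' Set.range (fiberι f t).left.base))
    (2 * 0))
  exact Subsingleton.elim _ _

/-- A scheme point of the fibre `𝒳_u` maps to the point of `S` underlying `u` (the fibre square; four lines of the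
tree's `apply_fiberι_base_eq_pt`, whose module is not imported here). [cite: Hartshorne1977, II.3 (p. 89)] -/
theorem base_fiberι_base_eq_pt (f : 𝒳 ⟶ S) (u : ComplexPoints S) (m : (fiberOver f u).left) :
    f.left.base ((fiberι f u).left.base m) = u.pt := by
  have h := congrArg (fun φ => φ.left.base m) (Motives.fiberι_comp f u)
  simp only [Over.comp_left, Scheme.Hom.comp_base, TopCat.coe_comp, Function.comp_apply] at h
  rw [h]
  change u.left.base _ = u.left.base (IsLocalRing.closedPoint ℂ)
  exact congrArg u.left.base (Subsingleton.elim (α := PrimeSpectrum ℂ) _ _)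

/-- **`j_s^*[𝒳_t] = 0` for ALL complex points `s, t` of the base: the fibre class dies on every fibre.** The base
is a smooth projective CURVE, so `S(ℂ)` is infinite (`Motives.infinite_algPoints`) and there is `t' ≠ s`; by (φ)
(`fibreClassConstantOn_holds`, part XIII-e) `[𝒳_t] = [𝒳_{t'}]`; the class `[𝒳_{t'}]` dies off `𝒳_{t'}` (previous
lemma) and the fibres `𝒳_s`, `𝒳_{t'}` are disjoint (a complex point of `𝒳_s` on `𝒳_{t'}` would give `s.pt = t'.pt`,
and complex points of `S` are its closed points), so `j_s^*` factors through the restriction to the complement.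
(The case `s = t` is the triviality of the normal bundle of a fibre, `[𝒳_t]|_{𝒳_t} = 0`, obtained here without any
normal-bundle calculus.) [cite: Fulton1998, §19.1 proof of Prop. 19.1.1 and §10.3 Example 10.3.2]
[cite: FultonYoungTableaux1997, Appendix B §B.2 Exercise 5] -/
theorem map_fiberι_fiberGysin_one_eq_zero {d : ℕ} {f : 𝒳 ⟶ S} (hf : IsCompactAbelianPencil f d)
    (t s : ComplexPoints S) :
    complexBetti.map (fiberι f s) (2 * (0 + 1))
      (fiberGysin hf t 0 (singularCohomology.one ℂ (ComplexPoints (fiberOver f t)))) = 0 := by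
  -- a second point `t' ≠ s` of the (infinite) base curve
  haveI : IsIntegral S.left := IsSmoothProjective.isIntegral_holds hf.isSmoothProjective_base
  haveI : SmoothOfRelativeDimension 1 S.hom := hf.isSmoothProjective_base.smoothOfRelativeDimension
  haveI : Infinite (ComplexPoints S) := Motives.infinite_algPoints S
  haveI := locallyOfFiniteType_of_isSmoothProjective hf.isSmoothProjective_base
  obtain ⟨t', ht'⟩ := exists_ne s
  rw [fibreClassConstantOn_holds hf t t']
  refine complexBetti_map_eq_zero_of_restrictCompl_eq_zero (fiberι f s) (S := Set.range (fiberι f t').left.base)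
    (fun Q hQ ↦ ht' ?_) (restrictCompl_range_fiberGysin_one_eq_zero hf t')
  -- a complex point of `𝒳_s` lying on `𝒳_{t'}` forces `t' = s`
  obtain ⟨y, hy⟩ := hQ
  have h1 : f.left.base ((fiberι f t').left.base y) = t'.pt := base_fiberι_base_eq_pt f t' y
  have h2 : f.left.base (AlgPoints.map (fiberι f s) Q).pt = s.pt := by
    rw [← AlgPoints.pt_map, AlgPoints.map_map_fiberι]
  rw [hy, h2] at h1
  apply (ComplexPoints.equivClosedPoints S).injective
  exact Subtype.ext (by
    rw [ComplexPoints.coe_equivClosedPoints_apply, ComplexPoints.coe_equivClosedPoints_apply]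
    exact h1.symm)

/-- `j_s^*(y ∪ [𝒳_t]) = 0` for every class `y` of the total space (pull-back is multiplicative).
[cite: HatcherAT2002, §3.2 Prop. 3.10] [cite: Fulton1998, §19.1 proof of Prop. 19.1.1] -/
theorem map_fiberι_cupProduct_fiberGysin_one_eq_zero {d : ℕ} {f : 𝒳 ⟶ S} (hf : IsCompactAbelianPencil f d)
    (t s : ComplexPoints S) {a b : ℕ} (h : a + 2 * (0 + 1) = b) (y : complexBetti 𝒳 a) :
    complexBetti.map (fiberι f s) b
      (cupProduct h y (fiberGysin hf t 0 (singularCohomology.one ℂ (ComplexPoints (fiberOver f t))))) = 0 := by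
  rw [complexBetti.map_cupProduct, map_fiberι_fiberGysin_one_eq_zero hf t s, map_zero]

/-- **`j_s^* ∘ L_t = 0`: `j_s^*(j_{t*} j_t^* W) = 0` for every global class `W` and all `s, t`** — the operator
inverted by (β′_f) has image in `ker j_s^* = L¹H` for every `s` (`j_{t*} j_t^* W = W ∪ [𝒳_t]`, part V, and the
previous lemma). [cite: FultonYoungTableaux1997, Appendix B §B.1 (6)] [cite: Abdulali1994FamiliesAV, (5.1)–(5.2) (p. 1130)] -/
theorem map_fiberι_fiberGysin_map_fiberι_eq_zero {d : ℕ} {f : 𝒳 ⟶ S} (hf : IsCompactAbelianPencil f d) {p : ℕ}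
    (W : complexBetti 𝒳 (2 * p)) (t s : ComplexPoints S) :
    complexBetti.map (fiberι f s) (2 * (p + 1)) (fiberGysin hf t p (complexBetti.map (fiberι f t) (2 * p) W)) = 0 := by
  rw [fiberGysin_map_fiberι_eq_cupProduct hf t W, map_fiberι_cupProduct_fiberGysin_one_eq_zero hf t s]

/-- **`[𝒳_t] ∪ [𝒳_{t'}] = 0`: the fibre class has square zero** (`[𝒳_t] ∪ j_{t'*} 1 = j_{t'*}(j_{t'}^*[𝒳_t] ∪ 1)
= j_{t'*} 0`, projection formula `complexGysin_cup` and §1). [cite: FultonYoungTableaux1997, Appendix B §B.1 (6)]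
[cite: Fulton1998, §10.3 Example 10.3.2] -/
theorem cupProduct_fiberGysin_one_eq_zero {d : ℕ} {f : 𝒳 ⟶ S} (hf : IsCompactAbelianPencil f d)
    (t t' : ComplexPoints S) :
    cupProduct (show 2 * (0 + 1) + 2 * (0 + 1) = 2 * (0 + 1 + 1) by ring)
      (fiberGysin hf t 0 (singularCohomology.one ℂ (ComplexPoints (fiberOver f t))))
      (fiberGysin hf t' 0 (singularCohomology.one ℂ (ComplexPoints (fiberOver f t')))) = 0 := by
  have h := complexGysin_cup (μ := complexOrientationFamily) hasPoincareDuality_complexOrientationFamily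
    (hf.isSmoothProjective_fiberOver t') hf.isSmoothProjective_total (fiberι f t') (Nat.add_zero (2 * (0 + 1)))
    (show 2 * (0 + 1) + 2 * (d + 1) = 2 * (0 + 1 + 1) + 2 * d by ring)
    (show 2 * 0 + 2 * (d + 1) = 2 * (0 + 1) + 2 * d by ring)
    (show 2 * (0 + 1) + 2 * (0 + 1) = 2 * (0 + 1 + 1) by ring)
    (fiberGysin hf t 0 (singularCohomology.one ℂ (ComplexPoints (fiberOver f t))))
    (singularCohomology.one ℂ (ComplexPoints (fiberOver f t')))
  rw [map_fiberι_fiberGysin_one_eq_zero hf t t', map_zero, LinearMap.zero_apply, map_zero] at h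
  exact h.symm

/-! ## §2 Balanced correspondences commute with cup product (general smooth projective `W`, `X`) -/

section Balanced

variable {m n : ℕ} {W X : SchemeOver ℂ}

/-- **A balanced correspondence commutes with cup product.** For `γ ∈ H^{2e}((W ⊗ X)(ℂ))`, `F ∈ Hᵏ(X(ℂ))`,
`G ∈ Hᵏ(W(ℂ))` with `γ ∪ pr_X^* F = γ ∪ pr_W^* G` ("`γ` is balanced with respect to `(F, G)`") and any
orientations `μ` of `(W ⊗ X)(ℂ)`, `ν` of `W(ℂ)` with `ν` satisfying Poincaré duality, the correspondence actions
`γ^* = pr_{W!}(pr_X^*(·) ∪ γ)` (Voisin II (10.7), the tree's `corrClassAction`) in degrees `a' → b'` and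
`a = a' + k → b = b' + k` satisfy **`γ^*(c ∪ F) = γ^*(c) ∪ G`**: `pr_X^*(c ∪ F) ∪ γ = pr_X^*c ∪ (pr_X^*F ∪ γ) =
pr_X^* c ∪ (γ ∪ pr_X^* F)` (even degree `2e`) `= pr_X^*c ∪ (γ ∪ pr_W^*G) = (pr_X^*c ∪ γ) ∪ pr_W^* G`, then the
projection formula `pr_{W!}(y ∪ pr_W^* x) = pr_{W!} y ∪ x` (Fulton App. B (6), sign-free form
`gysinMap_cupProduct_map`). [cite: VoisinHodgeII2003, proof of Thm. 10.17 (10.7)]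
[cite: FultonYoungTableaux1997, Appendix B §B.1 (6)] [cite: HatcherAT2002, §3.2 Prop. 3.10 and Thm. 3.11] -/
theorem corrClassAction_cupProduct_of_balanced
    (μ : HomologicalOrientation ℂ (ComplexPoints (W ⊗ X)) (2 * (m + n)))
    (ν : HomologicalOrientation ℂ (ComplexPoints W) (2 * m)) (hν : ν.HasPoincareDuality)
    {e k a b q a' b' q' : ℕ} (hab : a + 2 * e = b + 2 * n) (hq : b + q = 2 * m)
    (hab' : a' + 2 * e = b' + 2 * n) (hq' : b' + q' = 2 * m) (ha : a' + k = a) (hb : b' + k = b)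
    (γ : complexBetti (W ⊗ X) (2 * e)) (F : complexBetti X k) (G : complexBetti W k)
    (hγ : cupProduct (Nat.add_comm (2 * e) k) γ (complexBetti.map (snd W X) k F) =
      cupProduct (Nat.add_comm (2 * e) k) γ (complexBetti.map (fst W X) k G))
    (c : complexBetti X a') :
    corrClassAction μ ν hab hq γ (cupProduct ha c F) = cupProduct hb (corrClassAction μ ν hab' hq' γ c) G := by
  obtain rfl : q' = k + q := by omega
  rw [corrClassAction_apply, corrClassAction_apply, complexBetti.map_cupProduct,
    cupProduct_assoc ha (rfl : k + 2 * e = k + 2 * e) rfl (show a' + (k + 2 * e) = a + 2 * e by omega),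
    cupProduct_gradedComm_holds ℂ _ (rfl : k + 2 * e = k + 2 * e) (Nat.add_comm (2 * e) k)
      (complexBetti.map (snd W X) k F) γ,
    Even.neg_one_pow ⟨k * e, by ring⟩, one_smul, hγ,
    ← cupProduct_assoc (rfl : a' + 2 * e = a' + 2 * e) (Nat.add_comm (2 * e) k)
      (show a' + 2 * e + k = a + 2 * e by omega) (show a' + (k + 2 * e) = a + 2 * e by omega)]
  exact gysinMap_cupProduct_map hν (AlgPoints.mapContinuous (L := ℂ) (fst W X))
    (show a' + 2 * e + k = a + 2 * e by omega) (show a + 2 * e + q = 2 * (m + n) by omega) hq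
    (rfl : k + q = k + q) (show a' + 2 * e + (k + q) = 2 * (m + n) by omega) hq' hb _ G

/-- **Below the fibre dimension a balanced correspondence kills `c ∪ F` outright**: with `γ`, `F`, `G` as above and
`deg c + 2e < 2 dim X` (so that `γ^*(c)` would live in a negative degree), `γ^*(c ∪ F) = 0` — after the same
rearrangement, `pr_{W!}((pr_X^*c ∪ γ) ∪ pr_W^*G) ⌢ [W] = G ⌢ pr_{W*}((pr_X^* c ∪ γ) ⌢ [W ⊗ X])` and the homology
class `pr_{W*}(…)` lies in `H_j(W(ℂ))`, `j > 2 dim W`, which is zero (Hatcher Thm. 3.26 (c)); conclude by the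
injectivity of `⌢ [W]`. [cite: FultonYoungTableaux1997, Appendix B §B.1 (5)–(6)]
[cite: HatcherAT2002, §3.3 Thm. 3.26 (c), Thm. 3.30 and p. 241] -/
theorem corrClassAction_cupProduct_eq_zero_of_balanced_of_lt (hW : IsSmoothProjective m W)
    (μ : HomologicalOrientation ℂ (ComplexPoints (W ⊗ X)) (2 * (m + n)))
    (ν : HomologicalOrientation ℂ (ComplexPoints W) (2 * m)) (hν : ν.HasPoincareDuality)
    {e k a b q a' : ℕ} (hab : a + 2 * e = b + 2 * n) (hq : b + q = 2 * m) (ha : a' + k = a)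
    (hlt : a' + 2 * e < 2 * n)
    (γ : complexBetti (W ⊗ X) (2 * e)) (F : complexBetti X k) (G : complexBetti W k)
    (hγ : cupProduct (Nat.add_comm (2 * e) k) γ (complexBetti.map (snd W X) k F) =
      cupProduct (Nat.add_comm (2 * e) k) γ (complexBetti.map (fst W X) k G))
    (c : complexBetti X a') :
    corrClassAction μ ν hab hq γ (cupProduct ha c F) = 0 := by
  rw [corrClassAction_apply, complexBetti.map_cupProduct,
    cupProduct_assoc ha (rfl : k + 2 * e = k + 2 * e) rfl (show a' + (k + 2 * e) = a + 2 * e by omega),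
    cupProduct_gradedComm_holds ℂ _ (rfl : k + 2 * e = k + 2 * e) (Nat.add_comm (2 * e) k)
      (complexBetti.map (snd W X) k F) γ,
    Even.neg_one_pow ⟨k * e, by ring⟩, one_smul, hγ,
    ← cupProduct_assoc (rfl : a' + 2 * e = a' + 2 * e) (Nat.add_comm (2 * e) k)
      (show a' + 2 * e + k = a + 2 * e by omega) (show a' + (k + 2 * e) = a + 2 * e by omega)]
  set y := cupProduct (rfl : a' + 2 * e = a' + 2 * e) (complexBetti.map (snd W X) a' c) γ with hy
  apply (hν hq).1
  rw [map_zero, poincareDualityMap_apply,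
    capProduct_gysinMap hν (AlgPoints.mapContinuous (L := ℂ) (fst W X))
      (show a + 2 * e + q = 2 * (m + n) by omega) hq,
    cupProduct_capProduct (show a' + 2 * e + k = a + 2 * e by omega) (show a + 2 * e + q = 2 * (m + n) by omega)
      (rfl : k + q = k + q) (show a' + 2 * e + (k + q) = 2 * (m + n) by omega)]
  change singularHomology.map ℂ ℂ (AlgPoints.mapContinuous (L := ℂ) (fst W X)) q
    (capProduct rfl (singularCohomology.map ℂ ℂ (AlgPoints.mapContinuous (L := ℂ) (fst W X)) k G) _) = 0
  rw [capProduct_map]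
  have h0 : singularHomology.map ℂ ℂ (AlgPoints.mapContinuous (L := ℂ) (fst W X)) (k + q)
      (capProduct (show a' + 2 * e + (k + q) = 2 * (m + n) by omega) y μ.fundamentalClass) = 0 := by
    haveI := ModuleCat.subsingleton_of_isZero
      (ComplexPoints.isZero_singularHomology_of_lt hW ℂ ℂ (show 2 * m < k + q by omega))
    exact Subsingleton.elim _ _
  rw [h0, map_zero]

end Balanced

/-! ## §3 The no-go on compact pencils of abelian varieties -/

/-- For `p ≤ d` some class of `H²ᵖ(𝒳(ℂ))` survives on the fibre: `j_s^*(Kᵖ) = K_sᵖ ≠ 0` for an algebraic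
hyperplane-type class `K` (`K_sᵈ = L_{K_s}^{d-p} K_sᵖ ≠ 0`, part XIV-c). So `j_s^* ≠ 0` on `H²ᵖ(𝒳)` in the degrees
of (β′_f). [cite: VoisinHodgeI2002, §6.2.3 Thm. 6.25] [cite: HatcherAT2002, §3.1 p. 199] -/
theorem exists_map_fiberι_ne_zero {d : ℕ} {f : 𝒳 ⟶ S} (hf : IsCompactAbelianPencil f d) {p : ℕ} (hp : p ≤ d)
    (s : ComplexPoints S) : ∃ W : complexBetti 𝒳 (2 * p), complexBetti.map (fiberι f s) (2 * p) W ≠ 0 := by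
  obtain ⟨r, rfl⟩ : ∃ r, d = p + r := ⟨d - p, by omega⟩
  obtain ⟨K, -, hKL⟩ := exists_algebraic_lefschetzClass hf
  refine ⟨lefschetzPowTo K p 0 (2 * p) (by omega) (singularCohomology.one ℂ (ComplexPoints 𝒳)), fun h ↦ ?_⟩
  apply map_fiberι_lefschetzPowTo_one_ne_zero hf hKL (show 0 + 2 * (p + r) = 2 * (p + r) by omega) s
  rw [← lefschetzPowTo_lefschetzPowTo K r (show 0 + 2 * p = 2 * p by omega)
      (show 2 * p + 2 * r = 2 * (p + r) by omega) (show 0 + 2 * (p + r) = 2 * (p + r) by omega),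
    map_fiberι_lefschetzPowTo s K r (2 * p) (2 * (p + r)) (show 2 * p + 2 * r = 2 * (p + r) by omega), h, map_zero]

/-- **Operator form of the no-go.** Any linear `T : H^{2p+2}(𝒳) → H²ᵖ(𝒳)` which COMMUTES WITH CUP-BY-THE-FIBRE-CLASS
up to some `T'` — `T(x ∪ [𝒳_{t₀}]) = T'(x) ∪ [𝒳_{t₁}]` — satisfies `j_s^* T (j_{t*} j_t^* W) = 0` for all `W`, `t`,
`s` (`j_{t*}j_t^*W = W ∪ [𝒳_t] = W ∪ [𝒳_{t₀}]` by (φ), then §1). Algebraicity plays no role. [cite: Abdulali1994FamiliesAV, Conjecture 5.3 (p. 1130)]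
[cite: Fulton1998, §19.1 proof of Prop. 19.1.1] -/
theorem map_fiberι_apply_fiberGysin_eq_zero_of_commute {d : ℕ} {f : 𝒳 ⟶ S} (hf : IsCompactAbelianPencil f d)
    {p a : ℕ} (T : complexBetti 𝒳 (2 * (p + 1)) →ₗ[ℂ] complexBetti 𝒳 (2 * p))
    (T' : complexBetti 𝒳 (2 * p) →ₗ[ℂ] complexBetti 𝒳 a) (t₀ t₁ : ComplexPoints S) (h : a + 2 * (0 + 1) = 2 * p)
    (hT : ∀ x : complexBetti 𝒳 (2 * p),
      T (cupProduct (show 2 * p + 2 * (0 + 1) = 2 * (p + 1) by ring) x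
        (fiberGysin hf t₀ 0 (singularCohomology.one ℂ (ComplexPoints (fiberOver f t₀))))) =
      cupProduct h (T' x) (fiberGysin hf t₁ 0 (singularCohomology.one ℂ (ComplexPoints (fiberOver f t₁)))))
    (W : complexBetti 𝒳 (2 * p)) (t s : ComplexPoints S) :
    complexBetti.map (fiberι f s) (2 * p) (T (fiberGysin hf t p (complexBetti.map (fiberι f t) (2 * p) W))) = 0 := by
  rw [fiberGysin_map_fiberι_eq_cupProduct hf t W, fibreClassConstantOn_holds hf t t₀, hT,
    map_fiberι_cupProduct_fiberGysin_one_eq_zero hf t₁ s]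

/-- **THE NO-GO (restriction form).** Let `γ ∈ H^{2e}((𝒳 ⊗ 𝒳)(ℂ))` be BALANCED with respect to the fibre class,
`γ ∪ pr₂^*[𝒳_{t₀}] = γ ∪ pr₁^*[𝒳_{t₀}]`, and let `T = γ^* : H^{2p+2}(𝒳) → H²ᵖ(𝒳)` be its correspondence action
for any orientations (`ν` with Poincaré duality). Then **`j_s^*(T(j_{t*} j_t^* W)) = 0`** for every `W ∈ H²ᵖ(𝒳)`
and all `t, s`: for `p = 0`, `T(W ∪ [𝒳_t]) = 0` already (§2, `deg γ = 2d < 2(d+1)`); for `p ≥ 1`,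
`T(W ∪ [𝒳_t]) = γ^*_{2p → 2p-2}(W) ∪ [𝒳_{t₀}]` (§2) dies on every fibre (§1). In print every RELATIVE
correspondence of the abelian scheme (supported on `𝒳 ×_S 𝒳 ⊂ 𝒳 × 𝒳`: graphs of endomorphisms and isogenies
over `S`, the Poincaré bundle / relative Fourier–Mukai kernel, Deninger–Murre projectors, Künnemann's relative
`L`, `Λ`) is balanced, `[𝒳_t]` being `f^*[t]`. [cite: Abdulali1994FamiliesAV, Conjecture 5.3 (p. 1130)]
[cite: DeningerMurre1991, §2 and Thm. 3.1] [cite: Kunnemann1993, §3] [cite: VoisinHodgeII2003, proof of Thm. 10.17 (10.7)] -/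
theorem map_fiberι_corrClassAction_fiberGysin_eq_zero_of_balanced {d : ℕ} {f : 𝒳 ⟶ S}
    (hf : IsCompactAbelianPencil f d)
    (μ : HomologicalOrientation ℂ (ComplexPoints (𝒳 ⊗ 𝒳)) (2 * ((d + 1) + (d + 1))))
    (ν : HomologicalOrientation ℂ (ComplexPoints 𝒳) (2 * (d + 1))) (hν : ν.HasPoincareDuality)
    {p e q : ℕ} (hab : 2 * (p + 1) + 2 * e = 2 * p + 2 * (d + 1)) (hq : 2 * p + q = 2 * (d + 1))
    (γ : complexBetti (𝒳 ⊗ 𝒳) (2 * e)) (t₀ : ComplexPoints S)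
    (hγ : cupProduct (Nat.add_comm (2 * e) (2 * (0 + 1))) γ (complexBetti.map (snd 𝒳 𝒳) (2 * (0 + 1))
        (fiberGysin hf t₀ 0 (singularCohomology.one ℂ (ComplexPoints (fiberOver f t₀))))) =
      cupProduct (Nat.add_comm (2 * e) (2 * (0 + 1))) γ (complexBetti.map (fst 𝒳 𝒳) (2 * (0 + 1))
        (fiberGysin hf t₀ 0 (singularCohomology.one ℂ (ComplexPoints (fiberOver f t₀))))))
    (W : complexBetti 𝒳 (2 * p)) (t s : ComplexPoints S) :
    complexBetti.map (fiberι f s) (2 * p)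
      (corrClassAction μ ν hab hq γ (fiberGysin hf t p (complexBetti.map (fiberι f t) (2 * p) W))) = 0 := by
  rw [fiberGysin_map_fiberι_eq_cupProduct hf t W, fibreClassConstantOn_holds hf t t₀]
  rcases Nat.eq_zero_or_pos p with rfl | hp
  · rw [corrClassAction_cupProduct_eq_zero_of_balanced_of_lt hf.isSmoothProjective_total μ ν hν hab hq
      (show 2 * 0 + 2 * (0 + 1) = 2 * (0 + 1) by ring) (by omega) γ _ _ hγ W, map_zero]
  · obtain ⟨p', rfl⟩ : ∃ p', p = p' + 1 := ⟨p - 1, by omega⟩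
    rw [corrClassAction_cupProduct_of_balanced μ ν hν hab hq
      (show 2 * (p' + 1) + 2 * e = 2 * p' + 2 * (d + 1) by omega)
      (show 2 * p' + (2 * (0 + 1) + q) = 2 * (d + 1) by omega)
      (show 2 * (p' + 1) + 2 * (0 + 1) = 2 * (p' + 1 + 1) by ring) (show 2 * p' + 2 * (0 + 1) = 2 * (p' + 1) by ring)
      γ _ _ hγ W,
      map_fiberι_cupProduct_fiberGysin_one_eq_zero hf t₀ s]

/-- **THE NO-GO (witness form): a balanced correspondence never witnesses a clause `p ≤ d` of (β′_f).** With
`γ`, `T = γ^*` as above and `p ≤ d`, it is FALSE that `j_s^*(T(j_{t*}j_t^*W)) = j_s^*W` for all `W`, `t`, `s`: the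
left side vanishes identically while `j_{t₀}^* ≠ 0` on `H²ᵖ(𝒳)` (`exists_map_fiberι_ne_zero`). Hence the cycle
sought by `FibreClassLefschetzOn hf` in degree `p` (e.g. the codimension-6 cycle on the square of a (W_E)₃-pencil,
RING2-MAP AA2.45) is neither a product cycle through algebraic fibre classes (part XIV) nor balanced — in print: not
a relative cycle of the abelian scheme. [cite: Abdulali1994FamiliesAV, Conjecture 5.3 and Theorem 5.5 (p. 1130)]
[cite: Andre1996Motifs, §2.1 (p. 14) and Prop. 3.3 (p. 21)] [cite: DeningerMurre1991, Thm. 3.1] [cite: Kunnemann1993, §3] -/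
theorem not_fibreClassLefschetz_clause_of_balanced {d : ℕ} {f : 𝒳 ⟶ S} (hf : IsCompactAbelianPencil f d)
    (μ : HomologicalOrientation ℂ (ComplexPoints (𝒳 ⊗ 𝒳)) (2 * ((d + 1) + (d + 1))))
    (ν : HomologicalOrientation ℂ (ComplexPoints 𝒳) (2 * (d + 1))) (hν : ν.HasPoincareDuality)
    {p e q : ℕ} (hab : 2 * (p + 1) + 2 * e = 2 * p + 2 * (d + 1)) (hq : 2 * p + q = 2 * (d + 1))
    (γ : complexBetti (𝒳 ⊗ 𝒳) (2 * e)) (t₀ : ComplexPoints S)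
    (hγ : cupProduct (Nat.add_comm (2 * e) (2 * (0 + 1))) γ (complexBetti.map (snd 𝒳 𝒳) (2 * (0 + 1))
        (fiberGysin hf t₀ 0 (singularCohomology.one ℂ (ComplexPoints (fiberOver f t₀))))) =
      cupProduct (Nat.add_comm (2 * e) (2 * (0 + 1))) γ (complexBetti.map (fst 𝒳 𝒳) (2 * (0 + 1))
        (fiberGysin hf t₀ 0 (singularCohomology.one ℂ (ComplexPoints (fiberOver f t₀))))))
    (hp : p ≤ d) :
    ¬ ∀ (W : complexBetti 𝒳 (2 * p)) (t s : ComplexPoints S),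
        complexBetti.map (fiberι f s) (2 * p)
          (corrClassAction μ ν hab hq γ (fiberGysin hf t p (complexBetti.map (fiberι f t) (2 * p) W))) =
          complexBetti.map (fiberι f s) (2 * p) W := by
  intro h
  obtain ⟨W, hW⟩ := exists_map_fiberι_ne_zero hf hp t₀
  exact hW (by rw [← h W t₀ t₀, map_fiberι_corrClassAction_fiberGysin_eq_zero_of_balanced hf μ ν hν hab hq γ t₀ hγ])

end Summit.HodgeConjecture.HodgeConjecture.Ring2.AbelianAll

end
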